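import Mathlib
import Summits.ResolutionOfSingularities.ResolutionOfSingularities.Theorems.WildQuotientsWildQuotientResolutionThird112WeightZero
import Summits.ResolutionOfSingularities.ResolutionOfSingularities.Theorems.WildQuotientsWildQuotientResolutionToricExitRootChartInvariants

/-!
# V4U piece 0, B0-b (i): the `μ₃` chart subring of record IS the range of the `⅓(1,1,2)` presentation; weight bookkeeping

(crux stmt-ResolutionOfSingularities-15640 `WildQuotients.WildQuotientResolution`, line `Sketch`,
sector `|G| = p`; programme V4U of `L/w45c/CHAIN.md` v7.1 §4 row stub-1 (B0-b «transport to chart 0»)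
and `L/w45c/V4U-DESIGN.md` §2. [OURS · L1 W4.5c] — NOT a statement of any manuscript; replaces the
role of no printed item. Prover res-L1-w45c-stub-1.)

* `adjoin_chart0Gens_eq_range_presentation` — the chart subring of `D₊(x_a² t) ⊂ Bl_{I₆} 𝔸ⁿ` as
  presented by res-L1-w45c-stub-2's `JordanFour.chart0_ringEquiv_adjoin` (p490009; generators
  `range (ψ_A ∘ X) ∪ {1, X aX b², X bX c, X c³, X b³, X b²X c², X bX c⁴, X c⁶}`, `ψ_A : x_a ↦ X a³,
  x_b ↦ X b·X a², x_c ↦ X c·X a, x_i ↦ X i`) EQUALS `(Third112.presentation k n a b c).range` (B0-a,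
  res-type-035 p502264) — so it is exactly the `ZMod 3`-weight-`0` part for `Third112.coneWeight n a b c`
  (`mem_adjoin_chart0Gens_iff`).
* GENERIC: `weightedHomogeneousComponent_aeval` — weighted homogeneous components commute with a
  weight-preserving substitution (finite weight monoid); `weight_mul_left` /
  `isWeightedHomogeneous_zero_iff_of_mul` — rescaling a weight by a unit does not change the
  weight-`0` part (serves the permuted triple `(N, c′, ρ)` for `p ≡ 2 (mod 3)`).
-/

-- single-problem summit: the doubled namespace component `ResolutionOfSingularities` is forced
set_option linter.dupNamespace false

noncomputable section

open MvPolynomial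

namespace Summit.ResolutionOfSingularities.ResolutionOfSingularities.Theorems.WildQuotientResolution.JordanFour

section Generic

variable {R : Type*} [CommRing R] {ι τ M : Type*} [AddCommMonoid M]

/-- **Weighted homogeneous components commute with weight-preserving substitutions** (finite weight
monoid): if every `g i` is `w₂`-homogeneous of degree `w₁ i`, then
`(aeval g P)_m = aeval g (P_m)`. [folklore] -/
theorem weightedHomogeneousComponent_aeval [Fintype M] [DecidableEq M] (w₁ : ι → M) (w₂ : τ → M)
    (g : ι → MvPolynomial τ R) (hg : ∀ i, IsWeightedHomogeneous w₂ (g i) (w₁ i))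
    (P : MvPolynomial ι R) (m : M) :
    weightedHomogeneousComponent w₂ m (aeval g P) = aeval g (weightedHomogeneousComponent w₁ m P) := by
  conv_lhs => rw [← sum_weightedHomogeneousComponent w₁ P, finsum_eq_sum_of_fintype, map_sum, map_sum]
  have h : ∀ j, weightedHomogeneousComponent w₂ m (aeval g (weightedHomogeneousComponent w₁ j P)) =
      if m = j then aeval g (weightedHomogeneousComponent w₁ j P) else 0 := by
    intro j
    exact weightedHomogeneousComponent_of_mem ((mem_weightedHomogeneousSubmodule _ _ _ _).mpr
      (ToricExit.isWeightedHomogeneous_aeval w₁ w₂ g hg _ j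
        (weightedHomogeneousComponent_isWeightedHomogeneous j P)))
  simp_rw [h]
  rw [Finset.sum_ite_eq, if_pos (Finset.mem_univ m)]

/-- Rescaling a weight multiplies the weight of every exponent vector. [folklore] -/
theorem weight_mul_left {S : Type*} [CommSemiring S] (w : τ → S) (u : S) (d : τ →₀ ℕ) :
    Finsupp.weight (fun i => u * w i) d = u * Finsupp.weight w d := by
  rw [Finsupp.weight_apply, Finsupp.weight_apply, Finsupp.sum, Finsupp.sum, Finset.mul_sum]
  refine Finset.sum_congr rfl fun i _ => ?_
  rw [nsmul_eq_mul, nsmul_eq_mul]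
  ring

/-- **Rescaling a weight by a unit does not change the weight-`0` part.** [folklore] -/
theorem isWeightedHomogeneous_zero_iff_of_mul {S : Type*} [CommSemiring S] (w w' : τ → S) (u v : S)
    (huv : v * u = 1) (hw : ∀ i, w' i = u * w i) (f : MvPolynomial τ R) :
    IsWeightedHomogeneous w' f 0 ↔ IsWeightedHomogeneous w f 0 := by
  have hw' : w' = fun i => u * w i := funext hw
  subst hw'
  constructor
  · intro h d hd
    have h1 := h hd
    rw [weight_mul_left] at h1
    have h2 := congrArg (fun x => v * x) h1
    simp only [← mul_assoc, huv, one_mul, mul_zero] at h2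
    exact h2
  · intro h d hd
    rw [weight_mul_left, h hd, mul_zero]

end Generic

section Chart0

variable (k : Type) [Field k] (n : ℕ) (a b c : Fin n) (hab : a ≠ b) (hbc : b ≠ c) (hac : a ≠ c)

include hab hbc hac in
/-- **The chart-`0` subring of record is the range of the `⅓(1,1,2)` presentation.** The generators
of `JordanFour.chart0_ringEquiv_adjoin` (p490009) — `ψ_A(X s)` and
`1, X aX b², X bX c, X c³, X b³, X b²X c², X bX c⁴, X c⁶` — and the images of
`Third112.presentation k n a b c` generate the same subalgebra. [OURS · L1 W4.5c] -/
theorem adjoin_chart0Gens_eq_range_presentation :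
    Algebra.adjoin k
        (Set.range (fun s : Fin n => MvPolynomial.aeval
            (fun s : Fin n => (if s = a then X a ^ 3 else
              X s * X a ^ (if s = b then 2 else if s = c then 1 else 0) : MvPolynomial (Fin n) k))
            (X s : MvPolynomial (Fin n) k)) ∪
          Set.range (![1, X a * X b ^ 2, X b * X c, X c ^ 3, X b ^ 3, X b ^ 2 * X c ^ 2,
              X b * X c ^ 4, X c ^ 6] : Fin 8 → MvPolynomial (Fin n) k)) =
      (Third112.presentation k n a b c).range := by
  classical
  have hba : b ≠ a := fun h => hab h.symm
  have hca : c ≠ a := fun h => hac h.symm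
  have hcb : c ≠ b := fun h => hbc h.symm
  -- the presentation images
  have pa : Third112.presentation k n a b c (X (Sum.inl a)) = X a ^ 3 :=
    Third112.presentation_inl_a k n a b c
  have pb : Third112.presentation k n a b c (X (Sum.inl b)) = X b ^ 3 :=
    Third112.presentation_inl_b k n a b c hab
  have pc : Third112.presentation k n a b c (X (Sum.inl c)) = X c ^ 3 :=
    Third112.presentation_inl_c k n a b c hac hbc
  have pi : ∀ i, i ≠ a → i ≠ b → i ≠ c → Third112.presentation k n a b c (X (Sum.inl i)) = X i :=
    fun i hia hib hic => Third112.presentation_inl_of_ne k n a b c i hia hib hic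
  have p0 : Third112.presentation k n a b c (X (Sum.inr 0)) = X a ^ 2 * X b :=
    Third112.presentation_inr_zero k n a b c
  have p1 : Third112.presentation k n a b c (X (Sum.inr 1)) = X a * X b ^ 2 :=
    Third112.presentation_inr_one k n a b c
  have p2 : Third112.presentation k n a b c (X (Sum.inr 2)) = X a * X c :=
    Third112.presentation_inr_two k n a b c
  have p3 : Third112.presentation k n a b c (X (Sum.inr 3)) = X b * X c :=
    Third112.presentation_inr_three k n a b c
  set T := (Third112.presentation k n a b c).range with hT
  have memT : ∀ {x : MvPolynomial (Fin n) k} (y : MvPolynomial (Fin n ⊕ Fin 4) k),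
      Third112.presentation k n a b c y = x → x ∈ T :=
    fun y hy => (AlgHom.mem_range _).mpr ⟨y, hy⟩
  apply le_antisymm
  · refine Algebra.adjoin_le ?_
    rintro x hx
    rcases hx with ⟨s, rfl⟩ | ⟨j, rfl⟩
    · change MvPolynomial.aeval _ (X s) ∈ T
      rw [aeval_X]
      by_cases hsa : s = a
      · subst hsa; rw [if_pos rfl]; exact memT _ pa
      rw [if_neg hsa]
      by_cases hsb : s = b
      · subst hsb; rw [if_pos rfl]
        exact memT (X (Sum.inr 0)) (by rw [p0]; ring)
      rw [if_neg hsb]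
      by_cases hsc : s = c
      · subst hsc; rw [if_pos rfl]
        exact memT (X (Sum.inr 2)) (by rw [p2]; ring)
      · rw [if_neg hsc, pow_zero, mul_one]
        exact memT _ (pi s hsa hsb hsc)
    · fin_cases j
      · change (1 : MvPolynomial (Fin n) k) ∈ T
        exact T.one_mem
      · change X a * X b ^ 2 ∈ T
        exact memT _ p1
      · change X b * X c ∈ T
        exact memT _ p3
      · change X c ^ 3 ∈ T
        exact memT _ pc
      · change X b ^ 3 ∈ T
        exact memT _ pb
      · change X b ^ 2 * X c ^ 2 ∈ T
        exact memT (X (Sum.inr 3) ^ 2) (by rw [map_pow, p3]; ring)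
      · change X b * X c ^ 4 ∈ T
        exact memT (X (Sum.inr 3) * X (Sum.inl c)) (by rw [map_mul, p3, pc]; ring)
      · change X c ^ 6 ∈ T
        exact memT (X (Sum.inl c) ^ 2) (by rw [map_pow, pc]; ring)
  · set G := Set.range (fun s : Fin n => MvPolynomial.aeval
        (fun s : Fin n => (if s = a then X a ^ 3 else
          X s * X a ^ (if s = b then 2 else if s = c then 1 else 0) : MvPolynomial (Fin n) k))
        (X s : MvPolynomial (Fin n) k)) ∪
      Set.range (![1, X a * X b ^ 2, X b * X c, X c ^ 3, X b ^ 3, X b ^ 2 * X c ^ 2,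
          X b * X c ^ 4, X c ^ 6] : Fin 8 → MvPolynomial (Fin n) k) with hG
    have memψ : ∀ s : Fin n, MvPolynomial.aeval
        (fun s : Fin n => (if s = a then X a ^ 3 else
          X s * X a ^ (if s = b then 2 else if s = c then 1 else 0) : MvPolynomial (Fin n) k))
        (X s : MvPolynomial (Fin n) k) ∈ Algebra.adjoin k G :=
      fun s => Algebra.subset_adjoin (Or.inl ⟨s, rfl⟩)
    have memv : ∀ j : Fin 8, (![1, X a * X b ^ 2, X b * X c, X c ^ 3, X b ^ 3, X b ^ 2 * X c ^ 2,
        X b * X c ^ 4, X c ^ 6] : Fin 8 → MvPolynomial (Fin n) k) j ∈ Algebra.adjoin k G :=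
      fun j => Algebra.subset_adjoin (Or.inr ⟨j, rfl⟩)
    have ga : (X a ^ 3 : MvPolynomial (Fin n) k) ∈ Algebra.adjoin k G := by
      have h := memψ a; rwa [aeval_X, if_pos rfl] at h
    have gb : (X a ^ 2 * X b : MvPolynomial (Fin n) k) ∈ Algebra.adjoin k G := by
      have h := memψ b; rw [aeval_X, if_neg hba, if_pos rfl] at h
      have e : (X a ^ 2 * X b : MvPolynomial (Fin n) k) = X b * X a ^ 2 := by ring
      rwa [e]
    have gc : (X a * X c : MvPolynomial (Fin n) k) ∈ Algebra.adjoin k G := by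
      have h := memψ c; rw [aeval_X, if_neg hca, if_neg hcb, if_pos rfl] at h
      have e : (X a * X c : MvPolynomial (Fin n) k) = X c * X a ^ 1 := by ring
      rwa [e]
    have gi : ∀ i, i ≠ a → i ≠ b → i ≠ c → (X i : MvPolynomial (Fin n) k) ∈ Algebra.adjoin k G := by
      intro i hia hib hic
      have h := memψ i; rwa [aeval_X, if_neg hia, if_neg hib, if_neg hic, pow_zero, mul_one] at h
    rw [hT, Third112.range_presentation_eq_adjoin]
    refine Algebra.adjoin_le ?_
    rintro x ⟨s, rfl⟩
    rcases s with i | j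
    · change (if i = a then X a ^ 3 else if i = b then X b ^ 3 else if i = c then X c ^ 3 else X i) ∈ _
      by_cases hia : i = a
      · rw [if_pos hia]; exact ga
      rw [if_neg hia]
      by_cases hib : i = b
      · rw [if_pos hib]; exact memv 4
      rw [if_neg hib]
      by_cases hic : i = c
      · rw [if_pos hic]; exact memv 3
      · rw [if_neg hic]; exact gi i hia hib hic
    · fin_cases j
      · change X a ^ 2 * X b ∈ _
        exact gb
      · change X a * X b ^ 2 ∈ _
        exact memv 1
      · change X a * X c ∈ _
        exact gc
      · change X b * X c ∈ _
        exact memv 2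

include hab hbc hac in
/-- **The chart-`0` subring is the `μ₃`-weight-`0` part** (`Third112.coneWeight n a b c`:
`a, b ↦ 1`, `c ↦ 2`, passengers `↦ 0`). [OURS · L1 W4.5c] -/
theorem mem_adjoin_chart0Gens_iff (f : MvPolynomial (Fin n) k) :
    f ∈ Algebra.adjoin k
        (Set.range (fun s : Fin n => MvPolynomial.aeval
            (fun s : Fin n => (if s = a then X a ^ 3 else
              X s * X a ^ (if s = b then 2 else if s = c then 1 else 0) : MvPolynomial (Fin n) k))
            (X s : MvPolynomial (Fin n) k)) ∪
          Set.range (![1, X a * X b ^ 2, X b * X c, X c ^ 3, X b ^ 3, X b ^ 2 * X c ^ 2,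
              X b * X c ^ 4, X c ^ 6] : Fin 8 → MvPolynomial (Fin n) k)) ↔
      IsWeightedHomogeneous (Third112.coneWeight n a b c) f 0 := by
  rw [adjoin_chart0Gens_eq_range_presentation k n a b c hab hbc hac]
  exact Third112.mem_range_presentation_iff k n a b c hab hbc hac f

end Chart0

end Summit.ResolutionOfSingularities.ResolutionOfSingularities.Theorems.WildQuotientResolution.JordanFour

end
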